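import Literature.Analysis.SegalBargmann.SchrodingerSchwartzBridge
import HarnessLib

/-!
# Transport of the Schwartz-level Schrödinger formalism along a linear change of carrier `e : D ≃L[ℝ] ℝ^σ` (Folland 1989, §1.3)

Topic `Analysis/SegalBargmann`; namespace `Literature.Analysis.SegalBargmann`.  The bridge file T11
(`SchrodingerSchwartzBridge`) and the rigidity files behind it are written on the Folland carrier `𝓢(ℝ^σ, ℂ)` with
`ℝ^σ = (σ → ℝ)` and Lebesgue measure.  Consumers type their Schwartz spaces on other finite-dimensional real carriers
(`EuclideanSpace ℝ σ`, `ι → mixedSpace F`, …).  This file transports everything along a continuous linear equivalence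
`e : D ≃L[ℝ] (σ → ℝ)`, GENERICALLY in `D`, with the measure-compatibility of `e` as explicit `MeasurePreserving` binders
(never an instance):

* §1 `schwartzTransport e : 𝓢(D, ℂ) ≃L[ℂ] 𝓢(ℝ^σ, ℂ)`, `f ↦ f ∘ e⁻¹` (Mathlib `SchwartzMap.compCLMOfContinuousLinearEquiv`);
* §2 the Heisenberg operators on `𝓢(D)`: `rhoSD e p q := e^* ∘ rhoS p q ∘ (e⁻¹)^*`, pointwise
  `(rhoSD e p q f)(y) = e^{2πi q·(e y) + πi p·q} f(y + e⁻¹ p)` (`rhoSD_apply`), `schwartzTransport_rhoSD`;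
* §3 transport of operators and representations: `opTransport e : End(𝓢(D)) →* End(𝓢(ℝ^σ))` (conjugation),
  `repTransport e ρ : Representation ℂ G 𝓢(ℝ^σ, ℂ)`; continuity of orbit maps transports (`continuous_opTransport_apply`);
* §4 covariance: `IsPhaseCovariantSD e γ ωD` (covariance of a family on `𝓢(D)` w.r.t. `rhoSD`) is EQUIVALENT to
  `IsPhaseCovariantS γ (opTransport e ∘ ωD)` (`isPhaseCovariantS_opTransport_iff`), likewise `IsRhoCovariantSD`;
* §5 the `L²` side: `toL2D μ : 𝓢(D, ℂ) →L[ℂ] L²(D, μ)`, `l2Transport e hes : L²(D, μ) →ₗᵢ[ℂ] L²(ℝ^σ)` (`g ↦ g ∘ e⁻¹`, for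
  `hes : MeasurePreserving e.symm volume μ`), `toL2_schwartzTransport : toL2 (schwartzTransport e f) = l2Transport e hes (toL2D μ f)`,
  and transport of lifts: `LiftsToD μ A U` + an intertwining unitary `V` on `L²(ℝ^σ)` give `LiftsTo (opTransport e A) V`
  (`LiftsToD.transport`).

Everything is PROVED (no cited statement is used as a hypothesis).  Use (pub-hodgecm W2-∞ (γ)): the owner of `ωinf` on
`𝓢(ι → mixedSpace F, ℂ)` instantiates `e` once and consumes T11/T9/T4 through `repTransport` / §4 / §5.

## References

* [Folland1989] G. B. Folland, *Harmonic Analysis in Phase Space*, Princeton University Press, 1989, §1.3 (1.25).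
-/

noncomputable section

open MeasureTheory Complex SchwartzMap
open scoped InnerProductSpace ComplexConjugate Real FourierTransform

namespace Literature.Analysis.SegalBargmann

variable {σ : Type*} [Fintype σ] [DecidableEq σ]
variable {D : Type*} [NormedAddCommGroup D] [NormedSpace ℝ D]

local notation "L2R" σ => Lp ℂ 2 (volume : Measure (σ → ℝ))
local notation "SR" σ => SchwartzMap (σ → ℝ) ℂ
local notation "SD" D => SchwartzMap D ℂ

/-! ## 1. The Schwartz-space transport -/

omit [DecidableEq σ] in
/-- `(f ∘ e⁻¹) ∘ e = f` on Schwartz functions. [folklore] -/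
private theorem comp_comp_symm (e : D ≃L[ℝ] (σ → ℝ)) (f : SD D) :
    SchwartzMap.compCLMOfContinuousLinearEquiv ℂ e (SchwartzMap.compCLMOfContinuousLinearEquiv ℂ e.symm f) = f := by
  ext y
  simp

omit [DecidableEq σ] in
/-- `(f ∘ e) ∘ e⁻¹ = f` on Schwartz functions. [folklore] -/
private theorem comp_symm_comp (e : D ≃L[ℝ] (σ → ℝ)) (f : SR σ) :
    SchwartzMap.compCLMOfContinuousLinearEquiv ℂ e.symm (SchwartzMap.compCLMOfContinuousLinearEquiv ℂ e f) = f := by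
  ext x
  simp

/-- **`schwartzTransport e : 𝓢(D, ℂ) ≃L[ℂ] 𝓢(ℝ^σ, ℂ)`, `f ↦ f ∘ e⁻¹`.** [folklore] -/
def schwartzTransport (e : D ≃L[ℝ] (σ → ℝ)) : (SD D) ≃L[ℂ] SR σ :=
  ContinuousLinearEquiv.equivOfInverse (SchwartzMap.compCLMOfContinuousLinearEquiv ℂ e.symm)
    (SchwartzMap.compCLMOfContinuousLinearEquiv ℂ e) (comp_comp_symm e) (comp_symm_comp e)

omit [DecidableEq σ] in
/-- Pointwise: `schwartzTransport e f x = f (e⁻¹ x)`. [folklore] -/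
@[simp] theorem schwartzTransport_apply (e : D ≃L[ℝ] (σ → ℝ)) (f : SD D) (x : σ → ℝ) :
    schwartzTransport e f x = f (e.symm x) := rfl

omit [DecidableEq σ] in
/-- Pointwise: `(schwartzTransport e)⁻¹ f y = f (e y)`. [folklore] -/
@[simp] theorem schwartzTransport_symm_apply (e : D ≃L[ℝ] (σ → ℝ)) (f : SR σ) (y : D) :
    (schwartzTransport e).symm f y = f (e y) := rfl

/-! ## 2. The Heisenberg operators on `𝓢(D)` -/

/-- **Heisenberg operators on `𝓢(D)`**: `rhoSD e p q := (e)^* ∘ ρ(p,q) ∘ (e⁻¹)^*`. [cite: Folland1989, (1.25)] -/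
def rhoSD (e : D ≃L[ℝ] (σ → ℝ)) (p q : σ → ℝ) : (SD D) →L[ℂ] SD D :=
  ((schwartzTransport e).symm : (SR σ) →L[ℂ] SD D).comp ((rhoS p q).comp ((schwartzTransport e : (SD D) →L[ℂ] SR σ)))

omit [DecidableEq σ] in
/-- Pointwise formula: `(rhoSD e p q f)(y) = e^{2πi q·(e y) + πi p·q} f(y + e⁻¹ p)`. [cite: Folland1989, (1.25)] -/
@[simp] theorem rhoSD_apply (e : D ≃L[ℝ] (σ → ℝ)) (p q : σ → ℝ) (f : SD D) (y : D) :
    rhoSD e p q f y = rhoMul p q (e y) * f (y + e.symm p) := by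
  rw [rhoSD, ContinuousLinearMap.comp_apply, ContinuousLinearMap.comp_apply]
  show (schwartzTransport e).symm (rhoS p q (schwartzTransport e f)) y = _
  rw [schwartzTransport_symm_apply, rhoS_apply, schwartzTransport_apply, map_add, ContinuousLinearEquiv.symm_apply_apply]

omit [DecidableEq σ] in
/-- `schwartzTransport` intertwines `rhoSD` and `rhoS`. [folklore] -/
theorem schwartzTransport_rhoSD (e : D ≃L[ℝ] (σ → ℝ)) (p q : σ → ℝ) (f : SD D) :
    schwartzTransport e (rhoSD e p q f) = rhoS p q (schwartzTransport e f) := by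
  rw [rhoSD, ContinuousLinearMap.comp_apply, ContinuousLinearMap.comp_apply]
  exact (schwartzTransport e).apply_symm_apply _

omit [DecidableEq σ] in
/-- … and in the other direction. [folklore] -/
theorem schwartzTransport_symm_rhoS (e : D ≃L[ℝ] (σ → ℝ)) (p q : σ → ℝ) (f : SR σ) :
    (schwartzTransport e).symm (rhoS p q f) = rhoSD e p q ((schwartzTransport e).symm f) := by
  apply (schwartzTransport e).injective
  rw [schwartzTransport_rhoSD, ContinuousLinearEquiv.apply_symm_apply, ContinuousLinearEquiv.apply_symm_apply]

/-! ## 3. Transport of operators and representations -/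

/-- **Conjugation by `schwartzTransport e`**: `End(𝓢(D)) →* End(𝓢(ℝ^σ))`, `A ↦ e^* A (e^*)⁻¹`. [folklore] -/
def opTransport (e : D ≃L[ℝ] (σ → ℝ)) : ((SD D) →ₗ[ℂ] SD D) →* ((SR σ) →ₗ[ℂ] SR σ) where
  toFun A := ((schwartzTransport e : (SD D) ≃L[ℂ] SR σ) : (SD D) →ₗ[ℂ] SR σ).comp
    (A.comp (((schwartzTransport e).symm : (SR σ) ≃L[ℂ] SD D) : (SR σ) →ₗ[ℂ] SD D))
  map_one' := by
    apply LinearMap.ext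
    intro f
    show schwartzTransport e ((schwartzTransport e).symm f) = f
    exact (schwartzTransport e).apply_symm_apply f
  map_mul' A B := by
    apply LinearMap.ext
    intro f
    show schwartzTransport e (A (B ((schwartzTransport e).symm f))) =
      schwartzTransport e (A ((schwartzTransport e).symm (schwartzTransport e (B ((schwartzTransport e).symm f)))))
    rw [ContinuousLinearEquiv.symm_apply_apply]

omit [DecidableEq σ] in
/-- Unfolding. [folklore] -/
@[simp] theorem opTransport_apply (e : D ≃L[ℝ] (σ → ℝ)) (A : (SD D) →ₗ[ℂ] SD D) (f : SR σ) :
    opTransport e A f = schwartzTransport e (A ((schwartzTransport e).symm f)) := rfl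

omit [DecidableEq σ] in
/-- `opTransport e (rhoSD e p q) = rhoS p q`. [folklore] -/
theorem opTransport_rhoSD (e : D ≃L[ℝ] (σ → ℝ)) (p q : σ → ℝ) :
    opTransport e ((rhoSD e p q : (SD D) →L[ℂ] SD D) : (SD D) →ₗ[ℂ] SD D) =
      ((rhoS p q : (SR σ) →L[ℂ] SR σ) : (SR σ) →ₗ[ℂ] SR σ) := by
  apply LinearMap.ext
  intro f
  rw [opTransport_apply]
  show schwartzTransport e (rhoSD e p q ((schwartzTransport e).symm f)) = rhoS p q f
  rw [schwartzTransport_rhoSD, ContinuousLinearEquiv.apply_symm_apply]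

variable {G : Type*} [Group G]

/-- **Transport of a representation** on `𝓢(D)` to one on `𝓢(ℝ^σ)`. [folklore] -/
def repTransport (e : D ≃L[ℝ] (σ → ℝ)) (ρ : Representation ℂ G (SD D)) : Representation ℂ G (SR σ) :=
  (opTransport e).comp ρ

omit [DecidableEq σ] in
/-- Unfolding. [folklore] -/
@[simp] theorem repTransport_apply (e : D ≃L[ℝ] (σ → ℝ)) (ρ : Representation ℂ G (SD D)) (g : G) (f : SR σ) :
    repTransport e ρ g f = schwartzTransport e (ρ g ((schwartzTransport e).symm f)) := rfl

variable {H : Type*}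

omit [DecidableEq σ] in
/-- **Continuity of orbit maps transports** (the Schwartz topology on both sides). [folklore] -/
theorem continuous_opTransport_apply [TopologicalSpace H] (e : D ≃L[ℝ] (σ → ℝ)) {ωD : H → ((SD D) →ₗ[ℂ] SD D)}
    (hc : ∀ Φ : SD D, Continuous fun h => ωD h Φ) (Φ : SR σ) :
    Continuous fun h => opTransport e (ωD h) Φ := by
  simp only [opTransport_apply]
  exact (schwartzTransport e).continuous.comp (hc _)

/-! ## 4. Covariance on `𝓢(D)` -/

/-- Heisenberg covariance of a family of operators on `𝓢(D)`, w.r.t. the transported operators `rhoSD e`.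
[cite: Folland1989, §4.2, (4.23)] -/
def IsPhaseCovariantSD (e : D ≃L[ℝ] (σ → ℝ)) (γ : H → PhaseMap σ) (ωD : H → ((SD D) →ₗ[ℂ] SD D)) : Prop :=
  ∀ (h : H) (p q : σ → ℝ) (f : SD D),
    ωD h (rhoSD e p q f) = rhoSD e (γ h (p, q)).1 (γ h (p, q)).2 (ωD h f)

omit [DecidableEq σ] in
/-- **Covariance transports**: `IsPhaseCovariantS γ (opTransport e ∘ ωD) ↔ IsPhaseCovariantSD e γ ωD`. [folklore] -/
theorem isPhaseCovariantS_opTransport_iff (e : D ≃L[ℝ] (σ → ℝ)) (γ : H → PhaseMap σ)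
    (ωD : H → ((SD D) →ₗ[ℂ] SD D)) :
    IsPhaseCovariantS γ (fun h => opTransport e (ωD h)) ↔ IsPhaseCovariantSD e γ ωD := by
  constructor
  · intro hS h p q f
    have h1 := hS h p q (schwartzTransport e f)
    simp only [opTransport_apply, ContinuousLinearEquiv.symm_apply_apply] at h1
    rw [← schwartzTransport_rhoSD e p q f, ContinuousLinearEquiv.symm_apply_apply,
      ← schwartzTransport_rhoSD e _ _ (ωD h f)] at h1
    exact (schwartzTransport e).injective h1
  · intro hD h p q f
    simp only [opTransport_apply]
    rw [schwartzTransport_symm_rhoS, hD, schwartzTransport_rhoSD]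

/-- Covariance over a unitary family `ι : H → U(σ)` on `𝓢(D)`. [folklore] -/
def IsRhoCovariantSD (e : D ≃L[ℝ] (σ → ℝ)) (ι : H → Matrix.unitaryGroup σ ℂ) (ωD : H → ((SD D) →ₗ[ℂ] SD D)) : Prop :=
  IsPhaseCovariantSD e (fun h => realify (ι h)) ωD

/-- The unitary case transports. [folklore] -/
theorem isRhoCovariantS_opTransport_iff (e : D ≃L[ℝ] (σ → ℝ)) (ι : H → Matrix.unitaryGroup σ ℂ)
    (ωD : H → ((SD D) →ₗ[ℂ] SD D)) :
    IsRhoCovariantS ι (fun h => opTransport e (ωD h)) ↔ IsRhoCovariantSD e ι ωD :=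
  isPhaseCovariantS_opTransport_iff e _ ωD

/-! ## 5. The `L²` side -/

section L2

variable [MeasurableSpace D] [BorelSpace D] (μ : Measure D) [μ.HasTemperateGrowth]

/-- `toL2D μ : 𝓢(D, ℂ) →L[ℂ] L²(D, μ)`. [folklore] -/
def toL2D : (SD D) →L[ℂ] Lp ℂ 2 μ := SchwartzMap.toLpCLM ℂ ℂ 2 μ

omit [DecidableEq σ] [Fintype σ] in
/-- `toL2D μ f = f` a.e. [folklore] -/
theorem coeFn_toL2D (f : SD D) : ⇑(toL2D μ f) =ᵐ[μ] (f : D → ℂ) := SchwartzMap.coeFn_toLp f 2 μ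

omit [DecidableEq σ] [Fintype σ] in
/-- `toL2D μ` is injective when `μ` charges open sets. [folklore] -/
theorem toL2D_injective [μ.IsOpenPosMeasure] : Function.Injective (toL2D μ : (SD D) → Lp ℂ 2 μ) :=
  SchwartzMap.injective_toLp 2 μ

variable {μ}

/-- **The `L²` transport** `g ↦ g ∘ e⁻¹ : L²(D, μ) →ₗᵢ L²(ℝ^σ)`, for `e⁻¹` measure preserving. [folklore] -/
def l2Transport (e : D ≃L[ℝ] (σ → ℝ)) (hes : MeasurePreserving e.symm (volume : Measure (σ → ℝ)) μ) :
    Lp ℂ 2 μ →ₗᵢ[ℂ] L2R σ :=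
  Lp.compMeasurePreservingₗᵢ ℂ (e.symm : (σ → ℝ) → D) hes

omit [DecidableEq σ] [BorelSpace D] [μ.HasTemperateGrowth] in
/-- `l2Transport e hes g = g ∘ e⁻¹` a.e. [folklore] -/
theorem coeFn_l2Transport (e : D ≃L[ℝ] (σ → ℝ)) (hes : MeasurePreserving e.symm (volume : Measure (σ → ℝ)) μ)
    (g : Lp ℂ 2 μ) : ⇑(l2Transport e hes g) =ᵐ[volume] fun x => (g : D → ℂ) (e.symm x) :=
  Lp.coeFn_compMeasurePreserving g hes

omit [DecidableEq σ] in
/-- **The two embeddings commute with the transports**: `toL2 (f ∘ e⁻¹) = (toL2D f) ∘ e⁻¹`. [folklore] -/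
theorem toL2_schwartzTransport (e : D ≃L[ℝ] (σ → ℝ)) (hes : MeasurePreserving e.symm (volume : Measure (σ → ℝ)) μ)
    (f : SD D) : toL2 (schwartzTransport e f) = l2Transport e hes (toL2D μ f) := by
  apply Lp.ext
  have h1 := coeFn_toL2 (schwartzTransport e f)
  have h2 := coeFn_l2Transport e hes (toL2D μ f)
  have h3 : (fun x : σ → ℝ => (toL2D μ f : D → ℂ) (e.symm x)) =ᵐ[volume] fun x => (f : D → ℂ) (e.symm x) :=
    hes.quasiMeasurePreserving.ae_eq_comp (coeFn_toL2D μ f)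
  filter_upwards [h1, h2, h3] with x hx1 hx2 hx3
  rw [hx1, hx2, hx3, schwartzTransport_apply]

variable (μ) in
/-- `A` on `𝓢(D)` is the restriction of `U` on `L²(D, μ)`. [folklore] -/
def LiftsToD (A : (SD D) →ₗ[ℂ] SD D) (U : Lp ℂ 2 μ →L[ℂ] Lp ℂ 2 μ) : Prop := ∀ f : SD D, toL2D μ (A f) = U (toL2D μ f)

omit [DecidableEq σ] in
/-- **Lifts transport**: if `A` lifts to `U` on `L²(D)` and `V` on `L²(ℝ^σ)` intertwines `U` along `l2Transport`, then
`opTransport e A` lifts to `V`. [folklore] -/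
theorem LiftsToD.transport {e : D ≃L[ℝ] (σ → ℝ)} {hes : MeasurePreserving e.symm (volume : Measure (σ → ℝ)) μ}
    {A : (SD D) →ₗ[ℂ] SD D} {U : Lp ℂ 2 μ →L[ℂ] Lp ℂ 2 μ} {V : (L2R σ) →L[ℂ] L2R σ} (hA : LiftsToD μ A U)
    (hV : ∀ g : Lp ℂ 2 μ, l2Transport e hes (U g) = V (l2Transport e hes g)) : LiftsTo (opTransport e A) V := by
  intro f
  rw [opTransport_apply, toL2_schwartzTransport e hes, hA, hV, ← toL2_schwartzTransport e hes,
    ContinuousLinearEquiv.apply_symm_apply]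

end L2

end Literature.Analysis.SegalBargmann
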